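import Summits.ResolutionOfSingularities.ResolutionOfSingularities.Theorems.WeightedInvariantLexMaxOrderDropCompetitor
import HarnessLib

/-!
# The P3a cylinder move: the lex-face form of the special-fibre face and its degenerate shapes (ORDER (o36))

Topic: `Summits/ResolutionOfSingularities/ResolutionOfSingularities/Theorems`. Helper for the door item
`HypersurfaceCentreConstruction` (statement `stmt-ResolutionOfSingularities-19897`, route `WeightedInvariant`), line
`local-engine` of `res-L1-w43-plan-1`, IOTA3-DESIGN v1.3 §8.4 regime CURVE° (RULING gen 11 #2), ORDER (o36) held by
res-type-092 (design memo `plan/tools/res-type-092/o36/O36-DESIGN.md` §3/§4; kernel plan v2, FILE C2a).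

Pure polynomial algebra over a commutative ring / field `κ`, feeding res-type-098's face bound
`LexMaxOrderDrop.algebraMap_lexFace_notMem_pow` (coprime weights `(r, q)`, `q < r`) and res-type-078's K4 core
`LocalGameEFTFace.algebraMap_face_notMem_pow_of_notMem` (weights `(1, 1)`) with the special-fibre face form
`Φ = Σ_{face} c̄_α X^α` of `…P3aSpecialFibreFace`:

* `monomial_vec_two` — `monomial (a, b) c = C c · X₀^a · X₁^b`;
* **`exists_lexFacePolynomial`** — for coprime `r, q ≥ 1` a sum of monomials on the face `rα₀ + qα₁ = rν` is
  `Σ_{j ≤ deg P} C(P_j) X₀^{ν - qj} X₁^{rj}` for a polynomial `P` with `deg P ≤ ν / q` and prescribed coefficients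
  (res-type-098's reindexing `LexMaxOrderDrop.sum_face_reindex`);
* `lexFace_sum_eq_C_mul_pow` — the DEGENERATE SHAPE: if `P = c (s - l)^ν` then
  `Σ_{j ≤ ν} C(P_j) X_i^{ν-j} X_j^{rj} = C c · (X_j^r - l X_i)^ν`, and `X_j^r - l X_i = C(-l)·(X_i - l⁻¹ X_j^r)` over a field;
* `lexFace_sum_eq_of_natDegree_eq_zero` — `deg P = 0` gives `Φ = C(P₀) X_i^ν`;
* `X_sub_mem_of_pow_mem` bookkeeping: a prime containing `C u · L^ν` (`u ≠ 0`) contains `L`.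

Def-free.  [OURS · L1 W4.3] Replaces the role of NO printed item; NOT a statement of the manuscript under review
[claim: Hironaka2017, status: under-review].  AI work, weaker than expert review.

## References

* D. Abramovich, M. H. Quek, B. Schober, arXiv:2507.01232 (v3, 2026), Thm 1.3 (3), §5 (the face `f_{J,1}`).
  [AbramovichQuekSchober2025]
* J. Włodarczyk, *Functorial resolution by torus actions*, arXiv:2203.03090, §2.3.9. [Wlodarczyk2022]
-/

noncomputable section

open Polynomial

set_option linter.dupNamespace false -- mandated namespace of this single-conjunct summit

namespace Summit.ResolutionOfSingularities.ResolutionOfSingularities.Theorems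

namespace LocalGameEFTCylinder

variable {κ : Type} [CommRing κ]

/-! ### Monomials in two variables -/

/-- `monomial (a, b) c = C c · Xᵢ^a · Xⱼ^b` for `{i, j} = {0, 1}` in the order `![·,·]` prescribes:
`monomial ![a, b] c = C c * X 0 ^ a * X 1 ^ b`. [folklore] -/
theorem monomial_vec_two (a b : ℕ) (c : κ) :
    MvPolynomial.monomial (Finsupp.equivFunOnFinite.symm (![a, b] : Fin 2 → ℕ)) c =
      MvPolynomial.C c * MvPolynomial.X 0 ^ a * MvPolynomial.X 1 ^ b := by
  rw [MvPolynomial.monomial_eq, Finsupp.prod_fintype _ _ (fun i => pow_zero _), Fin.prod_univ_two, mul_assoc]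
  simp

/-! ### The lex-face polynomial -/

/-- **The lex-face form.**  `r, q ≥ 1` coprime, `ν : ℕ`, `Δ` a finite set of exponents and `c` coefficients.  There is
`P ∈ κ[s]` with `deg P ≤ ν / q`, `P_k = c(ν - qk, rk)` (or `0` off `Δ` / beyond `ν / q`), such that the sum of the
monomials of `Δ` ON THE FACE `rα₀ + qα₁ = rν` is `Σ_{j ≤ deg P} C(P_j) X₀^{ν - qj} X₁^{rj}`.
[cite: AbramovichQuekSchober2025, §5] -/
theorem exists_lexFacePolynomial {r q : ℕ} (hr : 0 < r) (hq : 0 < q) (hcop : Nat.Coprime r q) (ν : ℕ)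
    (Δ : Finset (Fin 2 → ℕ)) (c : (Fin 2 → ℕ) → κ) :
    ∃ P : κ[X], P.natDegree ≤ ν / q ∧
      (∀ k, P.coeff k = if k < ν / q + 1 then
        (if (![ν - q * k, r * k] : Fin 2 → ℕ) ∈ Δ then c ![ν - q * k, r * k] else 0) else 0) ∧
      ∑ α ∈ Δ.filter (fun α => r * α 0 + q * α 1 = r * ν),
          MvPolynomial.monomial (Finsupp.equivFunOnFinite.symm α) (c α) =
        ∑ j ∈ Finset.range (P.natDegree + 1),
          MvPolynomial.C (P.coeff j) * MvPolynomial.X 0 ^ (ν - q * j) * MvPolynomial.X 1 ^ (r * j) := by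
  classical
  set J : ℕ := ν / q with hJ
  obtain ⟨c', hc'⟩ : ∃ c' : ℕ → κ, ∀ k, c' k =
      if (![ν - q * k, r * k] : Fin 2 → ℕ) ∈ Δ then c ![ν - q * k, r * k] else 0 := ⟨_, fun k => rfl⟩
  set P : κ[X] := ∑ k ∈ Finset.range (J + 1), Polynomial.monomial k (c' k) with hP
  have hPcoeff : ∀ k, P.coeff k = if k < J + 1 then c' k else 0 := by
    intro k
    rw [hP, Polynomial.finsetSum_coeff]
    simp_rw [Polynomial.coeff_monomial]
    split_ifs with hk
    · rw [Finset.sum_eq_single k (fun k' _ hk' => if_neg hk') (fun h => absurd (Finset.mem_range.mpr hk) h),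
        if_pos rfl]
    · exact Finset.sum_eq_zero fun k' hk' => if_neg fun h => hk (by rw [← h]; exact Finset.mem_range.mp hk')
  have hdegP : P.natDegree ≤ J := by
    refine Polynomial.natDegree_sum_le_of_forall_le _ _ fun k hk => ?_
    exact (Polynomial.natDegree_monomial_le _).trans (Nat.lt_succ_iff.mp (Finset.mem_range.mp hk))
  refine ⟨P, hdegP, fun k => by rw [hPcoeff, hc'], ?_⟩
  rw [← LexMaxOrderDrop.sum_face_reindex hr hq hcop Δ]
  have hsub : Finset.range (P.natDegree + 1) ⊆ Finset.range (J + 1) := Finset.range_mono (Nat.succ_le_succ hdegP)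
  symm
  rw [Finset.sum_subset hsub (by
      intro k hk hk'
      rw [Polynomial.coeff_eq_zero_of_natDegree_lt (by have := Finset.mem_range.not.mp hk'; omega), map_zero,
        zero_mul, zero_mul]),
    ← Finset.sum_filter_add_sum_filter_not (Finset.range (J + 1))
      (fun j => (![ν - q * j, r * j] : Fin 2 → ℕ) ∈ Δ),
    Finset.sum_eq_zero (s := (Finset.range (J + 1)).filter (fun j => ¬ (![ν - q * j, r * j] : Fin 2 → ℕ) ∈ Δ)) (by
      intro j hj
      obtain ⟨hjr, hjΔ⟩ := Finset.mem_filter.mp hj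
      rw [hPcoeff, if_pos (Finset.mem_range.mp hjr), hc' j, if_neg hjΔ, map_zero, zero_mul, zero_mul]),
    add_zero]
  refine Finset.sum_congr rfl fun j hj => ?_
  obtain ⟨hjr, hjΔ⟩ := Finset.mem_filter.mp hj
  rw [hPcoeff, if_pos (Finset.mem_range.mp hjr), hc' j, if_pos hjΔ, monomial_vec_two]

/-! ### Degenerate shapes -/

/-- **The degenerate lex-face is a `ν`-th power.**  If `P = c (s - l)^ν` then
`Σ_{k ≤ ν} C(P_k) X_i^{ν - k} X_j^{rk} = C c · (X_j^r - l·X_i)^ν`. [cite: AbramovichQuekSchober2025, §5] -/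
theorem lexFace_sum_eq_C_mul_pow (i j : Fin 2) (r ν : ℕ) {P : κ[X]} {cc lb : κ} (hP : P = C cc * (X - C lb) ^ ν) :
    ∑ k ∈ Finset.range (ν + 1),
        MvPolynomial.C (P.coeff k) * MvPolynomial.X i ^ (ν - k) * MvPolynomial.X j ^ (r * k) =
      MvPolynomial.C cc * (MvPolynomial.X j ^ r - MvPolynomial.C lb * MvPolynomial.X i) ^ ν := by
  have hcoeff : ∀ k ∈ Finset.range (ν + 1), P.coeff k = cc * (ν.choose k : κ) * (-lb) ^ (ν - k) := by
    intro k _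
    rw [hP, Polynomial.coeff_C_mul, sub_eq_add_neg, ← Polynomial.C_neg, Polynomial.coeff_X_add_C_pow]
    ring
  rw [sub_eq_add_neg, add_pow, Finset.mul_sum]
  refine Finset.sum_congr rfl fun k hk => ?_
  rw [hcoeff k hk, map_mul, map_mul, map_natCast, map_pow, map_neg, pow_mul, ← neg_mul, mul_pow, ← map_neg]
  ring

/-- Over a field, `X_j^r - l·X_i = C(-l) · (X_i - l⁻¹·X_j^r)` for `l ≠ 0`. [folklore] -/
theorem X_pow_sub_C_mul_X_eq {κ : Type} [Field κ] (i j : Fin 2) (r : ℕ) {lb : κ} (hlb : lb ≠ 0) :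
    (MvPolynomial.X j ^ r - MvPolynomial.C lb * MvPolynomial.X i : MvPolynomial (Fin 2) κ) =
      MvPolynomial.C (-lb) * (MvPolynomial.X i - MvPolynomial.C lb⁻¹ * MvPolynomial.X j ^ r) := by
  have h : MvPolynomial.C lb * MvPolynomial.C lb⁻¹ = (1 : MvPolynomial (Fin 2) κ) := by
    rw [← map_mul, mul_inv_cancel₀ hlb, map_one]
  rw [map_neg]
  linear_combination (-(MvPolynomial.X j ^ r)) * h

/-- **The constant lex-face.**  If `deg P = 0` then `Σ_{j ≤ deg P} C(P_j) X_i^{ν - qj} X_j^{rj} = C(P₀) · X_i^ν`.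
[folklore] -/
theorem lexFace_sum_eq_of_natDegree_eq_zero (i j : Fin 2) (r q ν : ℕ) {P : κ[X]} (hP : P.natDegree = 0) :
    ∑ k ∈ Finset.range (P.natDegree + 1),
        MvPolynomial.C (P.coeff k) * MvPolynomial.X i ^ (ν - q * k) * MvPolynomial.X j ^ (r * k) =
      MvPolynomial.C (P.coeff 0) * MvPolynomial.X i ^ ν := by
  rw [hP, zero_add, Finset.sum_range_one, mul_zero, mul_zero, Nat.sub_zero, pow_zero, mul_one]

/-! ### Primes containing a degenerate face -/

/-- A prime of `κ[X₀, X₁]` (`κ` a field) containing `C u · L^ν` with `u ≠ 0` contains `L`. [folklore] -/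
theorem mem_of_C_mul_pow_mem {κ : Type} [Field κ] {𝔫 : Ideal (MvPolynomial (Fin 2) κ)} [𝔫.IsPrime] {u : κ}
    (hu : u ≠ 0) {L : MvPolynomial (Fin 2) κ} {ν : ℕ} (h : MvPolynomial.C u * L ^ ν ∈ 𝔫) : L ∈ 𝔫 := by
  rcases (‹𝔫.IsPrime›).mem_or_mem h with hC | hL
  · exact absurd (Ideal.eq_top_of_isUnit_mem _ hC ((isUnit_iff_ne_zero.mpr hu).map MvPolynomial.C))
      (‹𝔫.IsPrime›).ne_top
  · exact (‹𝔫.IsPrime›).mem_of_pow_mem ν hL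

/-- Off the vertex, a prime containing `Xᵢ - μ Xⱼ^r` (`r ≥ 1`) misses `Xⱼ`. [folklore] -/
theorem X_notMem_of_sub_mem {𝔫 : Ideal (MvPolynomial (Fin 2) κ)} {i j : Fin 2} (hij : i ≠ j) {μ : κ} {r : ℕ}
    (hr : 0 < r) (hW : MvPolynomial.X i - MvPolynomial.C μ * MvPolynomial.X j ^ r ∈ 𝔫)
    (hvert : ¬ Ideal.span {(MvPolynomial.X 0 : MvPolynomial (Fin 2) κ), MvPolynomial.X 1} ≤ 𝔫) :
    MvPolynomial.X j ∉ 𝔫 := by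
  intro hj
  have hi : MvPolynomial.X i ∈ 𝔫 := by
    have h1 : MvPolynomial.X i = (MvPolynomial.X i - MvPolynomial.C μ * MvPolynomial.X j ^ r) +
        MvPolynomial.C μ * MvPolynomial.X j ^ (r - 1) * MvPolynomial.X j := by
      rw [mul_assoc, ← pow_succ, Nat.sub_add_cancel hr]; ring
    rw [h1]
    exact Ideal.add_mem _ hW (Ideal.mul_mem_left _ _ hj)
  apply hvert
  rw [Ideal.span_le, Set.insert_subset_iff, Set.singleton_subset_iff]
  rcases Fin.exists_fin_two.mp ⟨i, rfl⟩ with h0 | h1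
  · have hj1 : j = 1 := by
      rcases Fin.exists_fin_two.mp ⟨j, rfl⟩ with hj0 | hj1
      · exact absurd (h0.trans hj0.symm) hij
      · exact hj1
    exact ⟨h0 ▸ hi, hj1 ▸ hj⟩
  · have hj0 : j = 0 := by
      rcases Fin.exists_fin_two.mp ⟨j, rfl⟩ with hj0 | hj1'
      · exact hj0
      · exact absurd (h1.trans hj1'.symm) hij
    exact ⟨hj0 ▸ hj, h1 ▸ hi⟩

end LocalGameEFTCylinder

end Summit.ResolutionOfSingularities.ResolutionOfSingularities.Theorems

end
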